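import Literature.MathematicalPhysics.QuantumLattice.HubbardBondAlgebra
import Literature.MathematicalPhysics.QuantumLattice.FermionOperatorsProofs
import Literature.Barriers.HubbardSuperconductivity.HohenbergMerminWagnerPairing
import HarnessLib

/-!
# Regional particle-number operators on the fermionic Fock space: diagonal form and charge calculus

Topic `MathematicalPhysics/QuantumLattice` (finite-dimensional CAR bookkeeping behind block decompositions of
lattice-fermion Hamiltonians; consumer: the thermal wedge of the Hubbard summit). On the Fock space `Finset ι → ℂ`
of a finite linearly ordered orbital set `ι` (Jordan–Wigner matrices of the tree, `annihilation`, `creation`),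
the particle number of an orbital set `S ⊆ ι` is the diagonal matrix `N_S = diag(s ↦ #(s ∩ S))` (written out, no
definition). Everything is PROVED; no definition and no named fact:

* `N_S` is Hermitian, `N_S = Σ_{i ∈ S} n_i`, additive over disjoint unions (`numberDiag_biUnion`);
* **charges**: `[N_S, c_i] = -[i ∈ S] c_i`, `[N_S, c†_i] = [i ∈ S] c†_i`; charges add under products
  (`comm_mul_of_comm_eq_smul`), flip sign under adjoints, and an operator of charge `q` has double commutator
  `[N, [X, N]]`-form `N(XN − NX) − (XN − NX)N = −q² X` (`doubleComm_of_comm_eq_smul`);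
* site level (`Orb Λ = Λ × {↑,↓}`, `S = orbs R`): the singlet bond pair `b_{xy}` has charge `−([x ∈ R] + [y ∈ R])`,
  the hopping term `c†_{xσ}c_{yσ}` has charge `[x ∈ R] − [y ∈ R]`; `N_{orbs R} = Σ_{x ∈ R, σ} n_{xσ}`, the second
  quantisation of an order embedding of site sets maps the total number to `N_{orbs (range)}`, the on-site operator
  `V_R(U, μ) = V_R(U, 0) − μ N_{orbs R}` and diagonal operators commute with `N_S`.

References: O. Bratteli, D. W. Robinson, *Operator Algebras and Quantum Statistical Mechanics II* (1997), §5.2.2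
(CAR algebra, gauge action / particle number grading) [cite: BratteliRobinsonII1997, §5.2.2]; H. Tasaki, *Physics
and Mathematics of Quantum Many-Body Systems* (2020), §9.2. All statements are [folklore].

Design note: every statement is parametric in the `DecidableEq` instance of the orbital/site type (on which `diagonal`,
`∩`, `⋃` depend syntactically), so that the lemmas apply verbatim on concrete lattices such as `FermionTorus 2 L`, whose
synthesised `DecidableEq` is not definitionally the one underlying `LinearOrder`; proofs that meet the tree's CAR
matrices substitute `LinearOrder.toDecidableEq`.
-/

noncomputable section

open Matrix Finset

namespace Literature.MathematicalPhysics.QuantumLattice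

/-! ### Commutator algebra (pure ring identities) -/

section Ring

variable {n : Type*} [Fintype n]

/-- Leibniz rule: `[N, XY] = [N, X] Y + X [N, Y]`. [folklore] -/
theorem comm_mul_eq_add (N X Y : Matrix n n ℂ) :
    N * (X * Y) - X * Y * N = (N * X - X * N) * Y + X * (N * Y - Y * N) := by
  noncomm_ring

/-- **Charges add under products**: `[N, X] = qX`, `[N, Y] = q'Y` imply `[N, XY] = (q + q') XY`. [folklore] -/
theorem comm_mul_of_comm_eq_smul {N X Y : Matrix n n ℂ} {q q' : ℂ} (hX : N * X - X * N = q • X)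
    (hY : N * Y - Y * N = q' • Y) : N * (X * Y) - X * Y * N = (q + q') • (X * Y) := by
  rw [comm_mul_eq_add, hX, hY, smul_mul_assoc, mul_smul_comm, add_smul]

/-- Charges are linear: `[N, X] = qX`, `[N, Y] = qY` imply `[N, X - Y] = q (X - Y)`. [folklore] -/
theorem comm_sub_of_comm_eq_smul {N X Y : Matrix n n ℂ} {q : ℂ} (hX : N * X - X * N = q • X)
    (hY : N * Y - Y * N = q • Y) : N * (X - Y) - (X - Y) * N = q • (X - Y) := by
  rw [Matrix.mul_sub, Matrix.sub_mul, smul_sub, ← hX, ← hY]; abel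

/-- Charges are linear: finite weighted sums of charge-`q` operators have charge `q`. [folklore] -/
theorem comm_sum_smul_of_comm_eq_smul {α : Type*} (s : Finset α) {N : Matrix n n ℂ}
    {X : α → Matrix n n ℂ} (c : α → ℂ) {q : ℂ} (hX : ∀ a ∈ s, N * X a - X a * N = q • X a) :
    N * (∑ a ∈ s, c a • X a) - (∑ a ∈ s, c a • X a) * N = q • ∑ a ∈ s, c a • X a := by
  rw [Finset.mul_sum, Finset.sum_mul, ← Finset.sum_sub_distrib, Finset.smul_sum]
  refine Finset.sum_congr rfl fun a ha => ?_
  rw [Matrix.mul_smul, Matrix.smul_mul, ← smul_sub, hX a ha, smul_comm]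

/-- **Adjoints flip the charge**: for Hermitian `N`, `[N, X] = qX` implies `[N, Xᴴ] = -q̄ Xᴴ`. [folklore] -/
theorem comm_conjTranspose_of_comm_eq_smul {N X : Matrix n n ℂ} (hN : Nᴴ = N) {q : ℂ}
    (hX : N * X - X * N = q • X) : N * Xᴴ - Xᴴ * N = (-(star q)) • Xᴴ := by
  have h := congrArg conjTranspose hX
  rw [conjTranspose_sub, conjTranspose_mul, conjTranspose_mul, hN, conjTranspose_smul] at h
  rw [neg_smul, ← h]; abel

/-- **Double commutator of a charge-`q` operator**: `[N, X] = qX` implies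
`N(XN − NX) − (XN − NX)N = −q² X`. [folklore] -/
theorem doubleComm_of_comm_eq_smul {N X : Matrix n n ℂ} {q : ℂ} (hX : N * X - X * N = q • X) :
    N * (X * N - N * X) - (X * N - N * X) * N = -(q ^ 2 • X) := by
  have h1 : X * N - N * X = -(q • X) := by rw [← hX]; abel
  rw [h1, Matrix.mul_neg, Matrix.neg_mul, Matrix.mul_smul, Matrix.smul_mul, neg_sub_neg, ← smul_sub,
    ← neg_sub, hX, smul_neg, smul_smul, pow_two]

/-- An operator commuting with `N` has vanishing double commutator. [folklore] -/
theorem doubleComm_of_comm_eq_zero {N X : Matrix n n ℂ} (hX : N * X - X * N = 0) :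
    N * (X * N - N * X) - (X * N - N * X) * N = 0 := by
  have h := doubleComm_of_comm_eq_smul (N := N) (X := X) (q := 0) (by rw [hX, zero_smul])
  simpa using h

/-- The double commutator is additive. [folklore] -/
theorem doubleComm_add (N X Y : Matrix n n ℂ) :
    N * ((X + Y) * N - N * (X + Y)) - ((X + Y) * N - N * (X + Y)) * N =
      (N * (X * N - N * X) - (X * N - N * X) * N) + (N * (Y * N - N * Y) - (Y * N - N * Y) * N) := by
  noncomm_ring

/-- The double commutator is subtractive. [folklore] -/
theorem doubleComm_sub (N X Y : Matrix n n ℂ) :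
    N * ((X - Y) * N - N * (X - Y)) - ((X - Y) * N - N * (X - Y)) * N =
      (N * (X * N - N * X) - (X * N - N * X) * N) - (N * (Y * N - N * Y) - (Y * N - N * Y) * N) := by
  noncomm_ring

/-- The double commutator is additive over finite sums. [folklore] -/
theorem doubleComm_sum {α : Type*} (s : Finset α) (N : Matrix n n ℂ) (X : α → Matrix n n ℂ) :
    N * ((∑ a ∈ s, X a) * N - N * ∑ a ∈ s, X a) - ((∑ a ∈ s, X a) * N - N * ∑ a ∈ s, X a) * N =
      ∑ a ∈ s, (N * (X a * N - N * X a) - (X a * N - N * X a) * N) := by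
  simp only [Finset.sum_mul, Finset.mul_sum, ← Finset.sum_sub_distrib]

/-- The double commutator is homogeneous. [folklore] -/
theorem doubleComm_smul (N X : Matrix n n ℂ) (c : ℂ) :
    N * ((c • X) * N - N * (c • X)) - ((c • X) * N - N * (c • X)) * N =
      c • (N * (X * N - N * X) - (X * N - N * X) * N) := by
  simp only [Matrix.smul_mul, Matrix.mul_smul, smul_sub, Matrix.mul_sub, Matrix.sub_mul]

end Ring

/-! ### The particle number of an orbital set -/

section Orbital

variable {ι : Type*} [LinearOrder ι] [DecidableEq ι] [Fintype ι]

omit [LinearOrder ι] [Fintype ι] in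
/-- `N_S = diag(#(s ∩ S))` is Hermitian (real diagonal). [folklore] -/
theorem numberDiag_conjTranspose (S : Finset ι) :
    (diagonal fun s : Finset ι => (((s ∩ S).card : ℕ) : ℂ))ᴴ = diagonal fun s : Finset ι => (((s ∩ S).card : ℕ) : ℂ) := by
  rw [diagonal_conjTranspose]
  congr 1
  funext s
  simp

/-- **Annihilation lowers the regional particle number**: `N_S c_i − c_i N_S = −[i ∈ S] c_i`. [folklore] -/
theorem numberDiag_comm_annihilation (S : Finset ι) (i : ι) :
    diagonal (fun s : Finset ι => (((s ∩ S).card : ℕ) : ℂ)) * annihilation i -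
        annihilation i * diagonal (fun s : Finset ι => (((s ∩ S).card : ℕ) : ℂ)) =
      (if i ∈ S then (-1 : ℂ) else 0) • annihilation i := by
  -- the statement is parametric in the `DecidableEq ι` instance; the CAR matrices carry `LinearOrder.toDecidableEq`
  obtain rfl : ‹DecidableEq ι› = LinearOrder.toDecidableEq := Subsingleton.elim _ _
  ext s t
  rw [Matrix.sub_apply, diagonal_mul, mul_diagonal, Matrix.smul_apply, annihilation_apply, smul_eq_mul]
  by_cases h : i ∉ s ∧ t = insert i s
  · rw [if_pos h, h.2]
    by_cases hi : i ∈ S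
    · have hnot : i ∉ s ∩ S := fun h' => h.1 (Finset.mem_inter.1 h').1
      rw [Finset.insert_inter_of_mem hi, Finset.card_insert_of_notMem hnot, if_pos hi]
      push_cast
      ring
    · rw [Finset.insert_inter_of_notMem hi, if_neg hi]
      ring
  · rw [if_neg h]
    simp

/-- **Creation raises the regional particle number**: `N_S c†_i − c†_i N_S = [i ∈ S] c†_i`. [folklore] -/
theorem numberDiag_comm_creation (S : Finset ι) (i : ι) :
    diagonal (fun s : Finset ι => (((s ∩ S).card : ℕ) : ℂ)) * creation i -
        creation i * diagonal (fun s : Finset ι => (((s ∩ S).card : ℕ) : ℂ)) =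
      (if i ∈ S then (1 : ℂ) else 0) • creation i := by
  have h := comm_conjTranspose_of_comm_eq_smul (numberDiag_conjTranspose S) (numberDiag_comm_annihilation S i)
  rw [annihilation_conjTranspose] at h
  rw [h]
  congr 1
  split_ifs <;> simp

/-- `N_S = Σ_{i ∈ S} n_i`. [folklore] -/
theorem sum_numberAt_eq_numberDiag (S : Finset ι) :
    ∑ i ∈ S, numberAt i = diagonal fun s : Finset ι => (((s ∩ S).card : ℕ) : ℂ) := by
  obtain rfl : ‹DecidableEq ι› = LinearOrder.toDecidableEq := Subsingleton.elim _ _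
  simp only [numberAt_eq_diagonal]
  ext s t
  simp only [Matrix.sum_apply, diagonal_apply]
  by_cases hst : s = t
  · subst hst
    simp only [if_true]
    rw [Finset.sum_boole, Finset.filter_mem_eq_inter, Finset.inter_comm]
  · simp [hst]

omit [LinearOrder ι] [Fintype ι] in
/-- **Additivity over disjoint orbital sets**: `N_{⋃_j S_j} = Σ_j N_{S_j}` for a pairwise disjoint family. [folklore] -/
theorem numberDiag_biUnion {J : Type*} (T : Finset J) (g : J → Finset ι)
    (hg : ∀ j ∈ T, ∀ j' ∈ T, j ≠ j' → Disjoint (g j) (g j')) :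
    diagonal (fun s : Finset ι => (((s ∩ T.biUnion g).card : ℕ) : ℂ)) =
      ∑ j ∈ T, diagonal fun s : Finset ι => (((s ∩ g j).card : ℕ) : ℂ) := by
  ext s t
  simp only [Matrix.sum_apply, diagonal_apply]
  by_cases hst : s = t
  · subst hst
    simp only [if_true]
    rw [Finset.inter_biUnion, Finset.card_biUnion]
    · push_cast; rfl
    · intro j hj j' hj' hne
      exact Finset.disjoint_left.2 fun i hi hi' =>
        Finset.disjoint_left.1 (hg j hj j' hj' hne) (Finset.mem_inter.1 hi).2 (Finset.mem_inter.1 hi').2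
  · simp [hst]

omit [LinearOrder ι] [Fintype ι] in
/-- `N_{S ∪ S'} = N_S + N_{S'}` for disjoint `S, S'`. [folklore] -/
theorem numberDiag_union {S S' : Finset ι} (h : Disjoint S S') :
    diagonal (fun s : Finset ι => (((s ∩ (S ∪ S')).card : ℕ) : ℂ)) =
      diagonal (fun s : Finset ι => (((s ∩ S).card : ℕ) : ℂ)) + diagonal fun s : Finset ι => (((s ∩ S').card : ℕ) : ℂ) := by
  rw [diagonal_add]
  congr 1
  funext s
  rw [Finset.inter_union_distrib_left, Finset.card_union_of_disjoint]
  · push_cast; rfl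
  · exact Finset.disjoint_left.2 fun i hi hi' =>
      Finset.disjoint_left.1 h (Finset.mem_inter.1 hi).2 (Finset.mem_inter.1 hi').2

omit [LinearOrder ι] in
/-- Diagonal matrices commute with `N_S`. [folklore] -/
theorem numberDiag_comm_diagonal (S : Finset ι) (d : Finset ι → ℂ) :
    diagonal (fun s : Finset ι => (((s ∩ S).card : ℕ) : ℂ)) * diagonal d -
      diagonal d * diagonal (fun s : Finset ι => (((s ∩ S).card : ℕ) : ℂ)) = 0 := by
  rw [diagonal_mul_diagonal, diagonal_mul_diagonal, sub_eq_zero]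
  congr 1
  funext s
  ring

end Orbital

/-! ### Site level: `Orb Λ = Λ × {↑, ↓}`, regions `R ⊆ Λ`, `S = orbs R` -/

section Site

open Literature.Barriers.HubbardSuperconductivity

variable {Λ : Type*} [LinearOrder Λ] [DecidableEq Λ] [Fintype Λ]

/-- **Charge of the singlet bond pair**: `N_{orbs R} b_{xy} − b_{xy} N_{orbs R} = −([x ∈ R] + [y ∈ R]) b_{xy}`. [folklore] -/
theorem numberDiag_comm_bondPair (R : Finset Λ) (x y : Λ) :
    diagonal (fun s : Finset (Orb Λ) => (((s ∩ orbs R).card : ℕ) : ℂ)) * bondPair x y -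
        bondPair x y * diagonal (fun s : Finset (Orb Λ) => (((s ∩ orbs R).card : ℕ) : ℂ)) =
      (-((((if x ∈ R then 1 else 0) + (if y ∈ R then 1 else 0) : ℕ) : ℂ))) • bondPair x y := by
  have ha : ∀ (z : Λ) (σ : Fin 2), diagonal (fun s : Finset (Orb Λ) => (((s ∩ orbs R).card : ℕ) : ℂ)) * annihilation (orb z σ) -
      annihilation (orb z σ) * diagonal (fun s : Finset (Orb Λ) => (((s ∩ orbs R).card : ℕ) : ℂ)) =
      (-(((if z ∈ R then 1 else 0 : ℕ) : ℂ))) • annihilation (orb z σ) := by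
    intro z σ
    rw [numberDiag_comm_annihilation (ι := Orb Λ)]
    congr 1
    by_cases hz : z ∈ R <;> simp [hz]
  unfold bondPair
  have h1 := comm_mul_of_comm_eq_smul (ha x 0) (ha y 1)
  have h2 := comm_mul_of_comm_eq_smul (ha x 1) (ha y 0)
  rw [comm_sub_of_comm_eq_smul h1 h2]
  congr 1
  push_cast
  ring

/-- **Charge of a hopping term**: `N_{orbs R} (c†_{xσ}c_{yτ}) − (c†_{xσ}c_{yτ}) N_{orbs R} = ([x ∈ R] − [y ∈ R]) c†_{xσ}c_{yτ}`.
[folklore] -/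
theorem numberDiag_comm_creation_mul_annihilation (R : Finset Λ) (x y : Λ) (σ τ : Fin 2) :
    diagonal (fun s : Finset (Orb Λ) => (((s ∩ orbs R).card : ℕ) : ℂ)) * (creation (orb x σ) * annihilation (orb y τ)) -
        creation (orb x σ) * annihilation (orb y τ) * diagonal (fun s : Finset (Orb Λ) => (((s ∩ orbs R).card : ℕ) : ℂ)) =
      ((((if x ∈ R then 1 else 0 : ℕ) : ℂ)) - (((if y ∈ R then 1 else 0 : ℕ) : ℂ))) • (creation (orb x σ) * annihilation (orb y τ)) := by
  have hc : diagonal (fun s : Finset (Orb Λ) => (((s ∩ orbs R).card : ℕ) : ℂ)) * creation (orb x σ) -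
      creation (orb x σ) * diagonal (fun s : Finset (Orb Λ) => (((s ∩ orbs R).card : ℕ) : ℂ)) =
      (((if x ∈ R then 1 else 0 : ℕ) : ℂ)) • creation (orb x σ) := by
    rw [numberDiag_comm_creation (ι := Orb Λ)]
    congr 1
    by_cases hx : x ∈ R <;> simp [hx]
  have ha : diagonal (fun s : Finset (Orb Λ) => (((s ∩ orbs R).card : ℕ) : ℂ)) * annihilation (orb y τ) -
      annihilation (orb y τ) * diagonal (fun s : Finset (Orb Λ) => (((s ∩ orbs R).card : ℕ) : ℂ)) =
      (-(((if y ∈ R then 1 else 0 : ℕ) : ℂ))) • annihilation (orb y τ) := by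
    rw [numberDiag_comm_annihilation (ι := Orb Λ)]
    congr 1
    by_cases hy : y ∈ R <;> simp [hy]
  rw [comm_mul_of_comm_eq_smul hc ha, sub_eq_add_neg]

/-- **The regional particle number as a sum of site number operators**: `N_{orbs R} = Σ_{x ∈ R} Σ_σ n_{xσ}`. [folklore] -/
theorem numberDiag_orbs_eq_sum_numberOp (R : Finset Λ) :
    diagonal (fun s : Finset (Orb Λ) => (((s ∩ orbs R).card : ℕ) : ℂ)) = ∑ x ∈ R, ∑ σ : Fin 2, numberOp x σ := by
  rw [← sum_numberAt_eq_numberDiag, orbs, Finset.sum_map, Finset.sum_product]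
  rfl

omit [DecidableEq Λ] in
/-- The second quantisation of an order embedding of site sets maps the total number of the small system to the
regional number of its range: `jwEmbed (orbEmb e) N = N_{orbs (e Λ)}`. [folklore] -/
theorem jwEmbed_totalNumber {Λ' : Type*} [LinearOrder Λ'] [DecidableEq Λ'] [Fintype Λ'] (e : Λ ↪o Λ') :
    jwEmbed (orbEmb e) (totalNumber : Matrix (Finset (Orb Λ)) (Finset (Orb Λ)) ℂ) =
      diagonal fun s : Finset (Orb Λ') => (((s ∩ orbs ((Finset.univ : Finset Λ).map e.toEmbedding)).card : ℕ) : ℂ) := by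
  rw [numberDiag_orbs_eq_sum_numberOp, totalNumber, map_sum, Finset.sum_map]
  refine Finset.sum_congr rfl fun x _ => ?_
  rw [map_sum]
  exact Finset.sum_congr rfl fun σ _ => jwEmbed_numberOp e x σ

/-- The total number is the regional number of all sites: `N = N_{orbs Λ}`. [folklore] -/
theorem totalNumber_eq_numberDiag_univ :
    (totalNumber : Matrix (Finset (Orb Λ)) (Finset (Orb Λ)) ℂ) =
      diagonal fun s : Finset (Orb Λ) => (((s ∩ orbs (Finset.univ : Finset Λ)).card : ℕ) : ℂ) := by
  rw [numberDiag_orbs_eq_sum_numberOp, totalNumber]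

/-- **Chemical potential shift of the on-site operator**: `V_R(U, μ) = V_R(U, 0) − μ N_{orbs R}`. [folklore] -/
theorem onSiteSum_eq_sub_smul_numberDiag (U μ : ℂ) (R : Finset Λ) :
    onSiteSum U μ R = onSiteSum U 0 R - μ • diagonal fun s : Finset (Orb Λ) => (((s ∩ orbs R).card : ℕ) : ℂ) := by
  rw [numberDiag_orbs_eq_sum_numberOp, onSiteSum, onSiteSum, Finset.smul_sum, ← Finset.sum_sub_distrib]
  refine Finset.sum_congr rfl fun x _ => ?_
  rw [onSiteOp, onSiteOp, zero_smul, sub_zero, Fin.sum_univ_two]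

/-- On-site operators commute with every regional number (both are diagonal). [folklore] -/
theorem numberDiag_comm_onSiteSum (S : Finset (Orb Λ)) (U μ : ℂ) (R : Finset Λ) :
    diagonal (fun s : Finset (Orb Λ) => (((s ∩ S).card : ℕ) : ℂ)) * onSiteSum U μ R -
      onSiteSum U μ R * diagonal (fun s : Finset (Orb Λ) => (((s ∩ S).card : ℕ) : ℂ)) = 0 := by
  obtain rfl : ‹DecidableEq Λ› = LinearOrder.toDecidableEq := Subsingleton.elim _ _
  rw [onSiteSum_eq_diagonal]
  exact numberDiag_comm_diagonal S _

omit [LinearOrder Λ] [Fintype Λ] in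
/-- A regional number is Hermitian. [folklore] -/
theorem isHermitian_numberDiag (S : Finset (Orb Λ)) :
    (diagonal fun s : Finset (Orb Λ) => (((s ∩ S).card : ℕ) : ℂ)).IsHermitian :=
  numberDiag_conjTranspose S

/-! ### Orbital sets of site sets -/

omit [LinearOrder Λ] [Fintype Λ] in
/-- `orbs (A ∪ B) = orbs A ∪ orbs B`. [folklore] -/
theorem orbs_union (A B : Finset Λ) : orbs (A ∪ B) = orbs A ∪ orbs B := by
  ext i
  simp [mem_orbs]

omit [LinearOrder Λ] [Fintype Λ] in
/-- `orbs (⋃_j g j) = ⋃_j orbs (g j)`. [folklore] -/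
theorem orbs_biUnion {J : Type*} (T : Finset J) (g : J → Finset Λ) :
    orbs (T.biUnion g) = T.biUnion fun j => orbs (g j) := by
  ext i
  simp [mem_orbs]

omit [LinearOrder Λ] [DecidableEq Λ] in
/-- `orbs Λ = all orbitals`. [folklore] -/
theorem orbs_univ : orbs (Finset.univ : Finset Λ) = Finset.univ := by
  ext i
  simp [mem_orbs]

omit [LinearOrder Λ] in
/-- `orbs Aᶜ = (orbs A)ᶜ`. [folklore] -/
theorem orbs_compl (A : Finset Λ) : orbs Aᶜ = (orbs A)ᶜ := by
  ext i
  simp [mem_orbs]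

omit [LinearOrder Λ] [DecidableEq Λ] [Fintype Λ] in
/-- `#(orbs A) = 2 #A`. [folklore] -/
theorem card_orbs (A : Finset Λ) : (orbs A).card = 2 * A.card := by
  rw [orbs, Finset.card_map, Finset.card_product, Finset.card_univ, Fintype.card_fin, mul_comm]

end Site

end Literature.MathematicalPhysics.QuantumLattice
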